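import Literature.AlgebraicGeometry.Motives.PicardQuarticPlaces
import Literature.NumberTheory.GaloisRepresentations.SuperellipticTorsionRep
import HarnessLib

/-!
# The Picard quartic: divisors and divisor classes of `K(X_F)` ↔ `Pic` of `K(x)[y]/(y³ - g)`

Continuing `Motives/PicardQuarticPlaces` (`placeCongr e : PlaceOver K F₁ ≃ PlaceOver K F₂` along a
`K`-algebra isomorphism of function fields, and the closed points of the Picard quartic
`X_F = hypersurface (picardForm g)` ↔ places of `K(x)[y]/(y³ - g)`), this file transports
**divisors, principal divisors, degrees and divisor classes** along `e : F₁ ≃ₐ[K] F₂`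
(Stichtenoth Lemma 3.5.2, for isomorphisms) and records the equivariance of all these transports
under automorphisms `g` acting compatibly on `F₁` and `F₂` (`e (g • x) = g • e x`):

* `CurvePlaces.divisorCongr e : Divisor K F₁ ≃+ Divisor K F₂` (`Σ n_P P ↦ Σ n_P e(P)`), with
  `degree_divisorCongr` (`deg` is preserved), **`divisorCongr_principalDivisor : e((x)) = (e x)`**,
  `map_principalDivisors` (`e(Princ F₁) = Princ F₂`);
* **`CurvePlaces.divisorClassCongr e : DivisorClass K F₁ ≃+ DivisorClass K F₂`**, `[D] ↦ [e D]`,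
  with `degree_divisorClassCongr`;
* equivariance: `placeCongr_smul`, `divisorCongr_smul`, `divisorClassCongr_smul`;
* for the Picard quartic (`3 ≠ 0`, `g` separable of degree `4`):
  **`PicardQuartic.divisorClassEquivPic : DivisorClass K K(X_F) ≃+ SuperellipticPic K K 3 g`**
  (the divisor class group of the function field of the SCHEME `X_F` is the group
  `SuperellipticPic` of `NumberTheory/GaloisRepresentations/SuperellipticTorsionRep` on which the
  Frobenius / Tate-module statements of `PicardFrobeniusDegDet` are formulated), preserving degrees
  (`degree_divisorClassEquivPic`).

Everything is proved; no named facts (D-0026).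

Mathlib searched (pin): `Finsupp.domCongr`, `Finsupp.equivMapDomain_apply`,
`Finsupp.equivMapDomain_single`, `QuotientAddGroup.congr`, `AddSubgroup.closure_le`,
`ValuationSubring.mem_pointwise_smul_iff_inv_smul_mem` (used).

## References

* H. Stichtenoth, *Algebraic Function Fields and Codes*, 2nd ed., GTM 254 (2009), Lemma 3.5.2
  and Def. 1.4.1–1.4.3 (divisors, principal divisors, class group). [Stichtenoth2009]
* R. Hartshorne, *Algebraic Geometry*, GTM 52 (1977), II.6 (divisors on curves; Cor. 6.6, 6.10).
  [Hartshorne1977]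
-/

noncomputable section

universe u v w

open CategoryTheory AlgebraicGeometry

namespace Literature.AlgebraicGeometry.Motives

open Literature.NumberTheory.DiophantineGeometry Literature.NumberTheory.DiophantineGeometry.AlgFunctionField
open Literature.NumberTheory.GaloisRepresentations

namespace CurvePlaces

/-! ### Transport of divisors and divisor classes along `e : F₁ ≃ₐ[K] F₂` -/

section DivisorTransport

variable {K : Type u} [Field K] {F₁ : Type v} {F₂ : Type w} [Field F₁] [Field F₂] [Algebra K F₁] [Algebra K F₂]

/-- **Transport of divisors** along a `K`-isomorphism of function fields: `Σ n_P P ↦ Σ n_P e(P)`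
(Stichtenoth Lemma 3.5.2). [cite: Stichtenoth2009, Lemma 3.5.2] -/
def divisorCongr (e : F₁ ≃ₐ[K] F₂) : Divisor K F₁ ≃+ Divisor K F₂ :=
  Finsupp.domCongr (placeCongr e)

/-- `(e D)(Q) = D(e⁻¹ Q)`. [folklore] -/
@[simp]
theorem divisorCongr_apply (e : F₁ ≃ₐ[K] F₂) (D : Divisor K F₁) (Q : PlaceOver K F₂) :
    divisorCongr e D Q = D ((placeCongr e).symm Q) := by
  simp [divisorCongr, Finsupp.equivMapDomain_apply]

/-- `e (n · P) = n · e(P)`. [folklore] -/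
@[simp]
theorem divisorCongr_single (e : F₁ ≃ₐ[K] F₂) (P : PlaceOver K F₁) (n : ℤ) :
    divisorCongr e (Finsupp.single P n) = Finsupp.single (placeCongr e P) n := by
  simp [divisorCongr]

/-- `(e⁻¹ D')(P) = D'(e P)`. [folklore] -/
@[simp]
theorem divisorCongr_symm_apply (e : F₁ ≃ₐ[K] F₂) (D : Divisor K F₂) (P : PlaceOver K F₁) :
    (divisorCongr e).symm D P = D (placeCongr e P) := by
  simp [divisorCongr, Finsupp.equivMapDomain_apply]

/-- **Transport preserves degrees of divisors**: `deg (e D) = deg D`. [cite: Stichtenoth2009, Lemma 3.5.2] -/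
@[simp]
theorem degree_divisorCongr (e : F₁ ≃ₐ[K] F₂) (D : Divisor K F₁) :
    Divisor.degree (divisorCongr e D) = Divisor.degree D := by
  have key : Divisor.degree.comp (divisorCongr e).toAddMonoidHom = Divisor.degree := by
    ext P
    simp [degree_placeCongr]
  exact DFunLike.congr_fun key D

/-- **The divisor of `e x` is `e` applied to the divisor of `x`**: `e((x)) = (e x)` (including the
junk case of `principalDivisor`). [cite: Stichtenoth2009, Lemma 3.5.2] -/
theorem divisorCongr_principalDivisor (e : F₁ ≃ₐ[K] F₂) (x : F₁) :
    divisorCongr e (principalDivisor K x) = principalDivisor K (e x) := by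
  classical
  have key : ∀ Q : PlaceOver K F₂, Q.ord (e x) = ((placeCongr e).symm Q).ord x :=
    fun Q => (ord_placeComap e Q x).symm
  have hset : {Q : PlaceOver K F₂ | Q.ord (e x) ≠ 0} = placeCongr e '' {P | P.ord x ≠ 0} := by
    ext Q
    simp only [Set.mem_setOf_eq, Set.mem_image, key]
    constructor
    · intro h
      exact ⟨(placeCongr e).symm Q, h, Equiv.apply_symm_apply _ _⟩
    · rintro ⟨P, hP, rfl⟩
      rwa [Equiv.symm_apply_apply]
  by_cases h : {P : PlaceOver K F₁ | P.ord x ≠ 0}.Finite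
  · have h' : {Q : PlaceOver K F₂ | Q.ord (e x) ≠ 0}.Finite := by
      rw [hset]
      exact h.image _
    ext Q
    rw [divisorCongr_apply, principalDivisor_apply h, principalDivisor_apply h', key]
  · have h' : ¬ {Q : PlaceOver K F₂ | Q.ord (e x) ≠ 0}.Finite := by
      intro h'
      rw [hset] at h'
      exact h (Set.Finite.of_finite_image h' (placeCongr e).injective.injOn)
    simp only [principalDivisor, dif_neg h, dif_neg h', map_zero]

/-- Principal divisors go to principal divisors. [folklore] -/
theorem _root_.Literature.NumberTheory.DiophantineGeometry.AlgFunctionField.Divisor.IsPrincipal.map_divisorCongr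
    (e : F₁ ≃ₐ[K] F₂) {D : Divisor K F₁} (hD : D.IsPrincipal) : (divisorCongr e D).IsPrincipal := by
  obtain ⟨x, hx, rfl⟩ := hD
  exact ⟨e x, (map_ne_zero e).mpr hx, (divisorCongr_principalDivisor e x).symm⟩

/-- **`e(Princ(F₁/K)) = Princ(F₂/K)`.** [cite: Stichtenoth2009, Lemma 3.5.2] -/
theorem map_principalDivisors (e : F₁ ≃ₐ[K] F₂) :
    (principalDivisors K F₁).map (divisorCongr e).toAddMonoidHom = principalDivisors K F₂ := by
  apply le_antisymm
  · rw [AddSubgroup.map_le_iff_le_comap]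
    exact (AddSubgroup.closure_le _).2 fun D hD => AddSubgroup.subset_closure (hD.map_divisorCongr e)
  · refine (AddSubgroup.closure_le _).2 fun D hD => ?_
    obtain ⟨y, hy, rfl⟩ := hD
    refine ⟨principalDivisor K (e.symm y), AddSubgroup.subset_closure ⟨e.symm y, (map_ne_zero e.symm).mpr hy, rfl⟩, ?_⟩
    change divisorCongr e (principalDivisor K (e.symm y)) = principalDivisor K y
    rw [divisorCongr_principalDivisor, AlgEquiv.apply_symm_apply]

/-- **Transport of divisor classes** along a `K`-isomorphism of function fields:
`Cl(F₁/K) ≃+ Cl(F₂/K)`, `[D] ↦ [e D]` (Stichtenoth Lemma 3.5.2). [cite: Stichtenoth2009, Lemma 3.5.2] -/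
def divisorClassCongr (e : F₁ ≃ₐ[K] F₂) : DivisorClass K F₁ ≃+ DivisorClass K F₂ :=
  QuotientAddGroup.congr (principalDivisors K F₁) (principalDivisors K F₂) (divisorCongr e) (map_principalDivisors e)

/-- `e [D] = [e D]`. [folklore] -/
@[simp]
theorem divisorClassCongr_mk (e : F₁ ≃ₐ[K] F₂) (D : Divisor K F₁) :
    divisorClassCongr e (DivisorClass.mk D) = DivisorClass.mk (divisorCongr e D) :=
  rfl

/-- `e⁻¹ [D'] = [e⁻¹ D']`. [folklore] -/
@[simp]
theorem divisorClassCongr_symm_mk (e : F₁ ≃ₐ[K] F₂) (D : Divisor K F₂) :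
    (divisorClassCongr e).symm (DivisorClass.mk D) = DivisorClass.mk ((divisorCongr e).symm D) :=
  rfl

/-- **Transport preserves degrees of divisor classes.** [cite: Stichtenoth2009, Lemma 3.5.2] -/
@[simp]
theorem degree_divisorClassCongr [IsAlgFunctionField K F₁] [IsAlgFunctionField K F₂] (e : F₁ ≃ₐ[K] F₂)
    (c : DivisorClass K F₁) : DivisorClass.degree (divisorClassCongr e c) = DivisorClass.degree c := by
  induction c using QuotientAddGroup.induction_on with
  | H D =>
    change DivisorClass.degree (DivisorClass.mk (divisorCongr e D)) = DivisorClass.degree (DivisorClass.mk D)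
    rw [DivisorClass.degree_mk, DivisorClass.degree_mk, degree_divisorCongr]

/-! ### Equivariance under compatible automorphisms -/

variable {G : Type*} [Group G] [MulSemiringAction G F₁] [MulSemiringAction G F₂]
  [IsConstantStable G K F₁] [IsConstantStable G K F₂]

/-- **`e(g P) = g e(P)`** when `e` intertwines the actions of `g` on `F₁` and `F₂`. [folklore] -/
theorem placeCongr_smul (e : F₁ ≃ₐ[K] F₂) (g : G) (he : ∀ x, e (g • x) = g • e x) (P : PlaceOver K F₁) :
    placeCongr e (g • P) = g • placeCongr e P := by
  have hinv : ∀ x, e (g⁻¹ • x) = g⁻¹ • e x := fun x => by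
    rw [eq_inv_smul_iff, ← he, smul_inv_smul]
  have he' : ∀ y, e.symm (g⁻¹ • y) = g⁻¹ • e.symm y := fun y => by
    apply e.injective
    rw [e.apply_symm_apply, hinv, e.apply_symm_apply]
  apply PlaceOver.ext
  ext y
  rw [mem_placeCongr_iff, toValuationSubring_smul, toValuationSubring_smul,
    ValuationSubring.mem_pointwise_smul_iff_inv_smul_mem, ValuationSubring.mem_pointwise_smul_iff_inv_smul_mem,
    mem_placeCongr_iff, he']

/-- `e⁻¹(g Q) = g e⁻¹(Q)`. [folklore] -/
theorem placeCongr_symm_smul (e : F₁ ≃ₐ[K] F₂) (g : G) (he : ∀ x, e (g • x) = g • e x) (Q : PlaceOver K F₂) :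
    (placeCongr e).symm (g • Q) = g • (placeCongr e).symm Q := by
  rw [Equiv.symm_apply_eq, placeCongr_smul e g he, Equiv.apply_symm_apply]

attribute [local instance] Finsupp.comapSMul Finsupp.comapMulAction Finsupp.comapDistribMulAction

/-- **`e(g D) = g e(D)`** on divisors. [folklore] -/
theorem divisorCongr_smul (e : F₁ ≃ₐ[K] F₂) (g : G) (he : ∀ x, e (g • x) = g • e x) (D : Divisor K F₁) :
    divisorCongr e (g • D) = g • divisorCongr e D := by
  ext Q
  rw [divisorCongr_apply, smul_divisor_apply, smul_divisor_apply, divisorCongr_apply, placeCongr_symm_smul e g⁻¹ _ Q]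
  intro x
  apply smul_left_cancel g
  rw [smul_inv_smul, ← he, smul_inv_smul]

attribute [local instance] divisorClassDistribMulAction

/-- **`e(g c) = g e(c)`** on divisor classes. [folklore] -/
theorem divisorClassCongr_smul (e : F₁ ≃ₐ[K] F₂) (g : G) (he : ∀ x, e (g • x) = g • e x) (c : DivisorClass K F₁) :
    divisorClassCongr e (g • c) = g • divisorClassCongr e c := by
  induction c using QuotientAddGroup.induction_on with
  | H D =>
    change divisorClassCongr e (DivisorClass.mk (g • D)) = DivisorClass.mk (g • divisorCongr e D)
    rw [divisorClassCongr_mk, divisorCongr_smul e g he]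

end DivisorTransport

end CurvePlaces

/-! ### The Picard quartic: `Cl(K(X_F)) ≃+ Pic(C_g) = SuperellipticPic K K 3 g` -/

namespace PicardQuartic

open SmoothHypersurface CurvePlaces

variable {K : Type u} [Field K] {g : Polynomial K} (hsep : g.Separable) (hg : g.natDegree = 4)
variable [Fact (Irreducible (superellipticPoly K K 3 g))] [IsIntegral (hypersurface (picardForm g)).left]

/-- **The divisor class group of the function field of the Picard quartic is `Pic(C_g)`**:
`Cl(K(X_F)/K) ≃+ SuperellipticPic K K 3 g = Cl(K(x)[y]/(y³ - g) / K)`, transported along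
`functionFieldAlgEquiv : K(X_F) ≃ₐ[K] K(x)[y]/(y³ - g)`. [cite: Stichtenoth2009, Lemma 3.5.2] -/
def divisorClassEquivPic :
    DivisorClass K (hypersurface (picardForm g)).left.functionField ≃+ SuperellipticPic K K 3 g :=
  divisorClassCongr (functionFieldAlgEquiv hsep hg)

/-- Unfolding: `divisorClassEquivPic [D] = [e D]`. [folklore] -/
@[simp]
theorem divisorClassEquivPic_mk (D : Divisor K (hypersurface (picardForm g)).left.functionField) :
    divisorClassEquivPic hsep hg (DivisorClass.mk D) =
      (SuperellipticPic.mk (divisorCongr (functionFieldAlgEquiv hsep hg) D) : SuperellipticPic K K 3 g) :=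
  rfl

/-- **`divisorClassEquivPic` preserves degrees** (for `K(X_F)` an algebraic function field over `K`,
e.g. via `isAlgFunctionField_of_smoothCurve`). [cite: Stichtenoth2009, Lemma 3.5.2] -/
theorem degree_divisorClassEquivPic [IsAlgFunctionField K (hypersurface (picardForm g)).left.functionField]
    (c : DivisorClass K (hypersurface (picardForm g)).left.functionField) :
    SuperellipticPic.degree K K 3 g (divisorClassEquivPic hsep hg c) = DivisorClass.degree c := by
  induction c using QuotientAddGroup.induction_on with
  | H D =>
    change SuperellipticPic.degree K K 3 g (SuperellipticPic.mk _) = DivisorClass.degree (DivisorClass.mk D)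
    rw [SuperellipticPic.degree_mk, DivisorClass.degree_mk]
    exact degree_divisorCongr _ D

end PicardQuartic

end Literature.AlgebraicGeometry.Motives
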